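import Summits.QuantumFields.BalabanUV.Beta.GAN24.WoodburyFibreLandauLimit

/-!
# Beta / GAN24 / WoodburyFibreProjector — census row V11: BAŁABAN'S PROJECTION `R` AT `U = 1` — the kernel `R(1) = L·𝒮·L` of
an2's brick (G″) IS the coprojector of King's one-form minimiser columns (exact), is the orthogonal projection onto `L(N(Q))`, and
`1 − R` is SMALL AND DECAYING UNIFORMLY IN THE SCALE on Bałaban's Neumann boxes

Cell `pub-balaban`, β sub-cell, BINDER ROW **G-an2-4 ∕ (CONV-C)** («NOT IN PRINT; our proof attempt»), prover part **P3 = WOODBURY-FIBRE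
reduction** (lineage `b2b-balaban-gan24-p3`, gen 7).  HONEST FRAMING (verbatim): discharging `BetaPertH` makes Bałaban's UV stability
UNCONDITIONAL — a real constructive-QFT result; it is NOT the continuum limit and NOT the Clay problem.  HONEST DEPENDENCY: continuum YM
on T⁴ ⇐ BetaPertH ∧ nine spine estimates (0/9 proved); BetaPertH ⇐ (D1) ∧ (D4) ∧ CAP+tail; G-an2-4 gates asym, D1 and NE2/3/4.
`[folklore]` matrix algebra over gen 1's `kkt` vocabulary (`PropagatorWoodburyFibre`), R17 (`WoodburyFibreGaugeSection`) and gen 6's box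
objects; 0 sorry; nothing printed and nothing programme-internal is a hypothesis.  NOT (CONV-C), NOT «G-an2-4 closed», NOT `BetaPertH`.

WHY.  an2's brick table (HOME/BETA/AN2.md §16.4) lists for brick (G″) — the block-sum-constrained inverse `𝒮` of the SQUARED Laplacian
(`Beta/BiLaplaceBlockKKT.Sb`) — «still located, not typed: R(1) = L𝒮L as a kernel and its projection property; …; every N-uniformity».
Gen 6 typed the N-uniform decay of `Sb` (`WoodburyFibreLandauZd.Sb_decay_uniform`); this file types `R(1)` (the `ℤ^{d+1}` reading for
`Sb` itself is the sequel `WoodburyFibreProjectorZd`).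

CONTEXT LOCATORS (print; NOT hypotheses).  [B9] = T. Bałaban, *Propagators for lattice gauge theories in a background field*, Commun.
Math. Phys. **99** (1985) 389–434, p. 394: (3.21) «R = R(U) is an orthogonal projection in the Hilbert space L²(Ω₀, g) onto the subspace
ℛ = Δ_U N(Q′), N(Q′) = {λ : Q′λ = 0}»; (3.22) «Rf = Δ_U λ₀ where λ₀ is a minimum of the function λ ∈ N(Q′), λ → ‖f − Δ_U λ‖²»; (3.25)
«Rf = (I − G′Q′*(Q′G′²Q′*)⁻¹Q′G′)f, where G′ = (Δ′_a)⁻¹»; p. 426 l. 2–6 (2.27) «𝒮 = G′² − G′²Q′*(Q′G′²Q′*)⁻¹Q′G′²».  Here: `U = 1`,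
sharp constraint, Neumann boxes at `A = 0`.

CONTENTS.  §1 `coproj (X·A) = coproj X` (`A` a unit); `tr (coproj X) = #rows − #columns`.  §2 (regularised one-form system `H_T = L + QᴴTQ`,
objects `Γ, ℋ, E`): **`L·flucCov(L·L + QᴴT₂Q, Q)·L = coproj ℋ`** (R17's `flucCov_sq_reg = Γ·coproj ℋ·Γ` sandwiched by `L`; cross terms die by
`ℋᴴ·coproj ℋ = 0 = coproj ℋ·ℋ`, `LΓ = 1 − Qᴴℋᴴ`, `ΓL = 1 − ℋQ`); the (3.25) shape; `coproj ℋ` fixes `L κ` for `Q κ = 0` ((3.21) ⊇;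
⊆ is `R = L·(𝒮·L)`, `Q·𝒮 = 0`, recorded on the box in §3); Hermitian idempotent by R17.  §2b the variational reading (3.22).  §3 on Bałaban's Neumann boxes at `A = 0` (gen 6's
objects): `projR n M := L_n·Γ^{Landau}_n·L_n = coproj ℋ̃`, `ℋ̃ = minimiser (boxOpR n 1 0 M) Qn` (`H_k(□)` in the unitary normalisation); symmetric,
idempotent, trace `#sites − #blocks`, fixes `L_n κ` for `Sκ = 0`, minimises `‖v − L_n κ‖²` over `Sκ = 0`, (3.25) shape; and **UNIFORMLY IN THE SCALE
`n = L^k`: `|(1 − R)(x, y)| ≤ C·n^{−(d+1)}·e^{−δ|blk x − blk y|_∞}`, `Σ_{y ∈ b′}|(1 − R)(x, y)| ≤ C·e^{−δ|blk x − b′|_∞}`** (`one_sub_projR_decay`;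
`1 − R = ℋ̃(ℋ̃ᴴℋ̃)⁻¹ℋ̃ᴴ`, the rank-`#blocks` projector onto the minimiser columns, from gen 6's decays of `ℋ̃` — B4 (1.10) `B4Thm110ZeroBox` + the
box (2.76) coercivity `qGq_box_coercive` BY NAME — and finite Combes–Thomas on `ℋ̃ᴴℋ̃ ⪰ 1`).
-/

namespace Summit.QuantumFields.BalabanUV.Beta.GAN24.WoodburyFibreProjector

open Finset Matrix
open Summit.QuantumFields.BalabanUV.Beta.PropagatorWoodburyFibre
open Summit.QuantumFields.BalabanUV.Beta.GAN24.WoodburyFibreGaugeSection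

section Algebra

variable {𝕜 : Type*} [Field 𝕜] [StarRing 𝕜]
variable {m n : Type*} [Fintype m] [Fintype n] [DecidableEq m] [DecidableEq n]

/-! ## §1 Two facts about coprojectors -/

/-- **the coprojector only sees the column SPACE**: `coproj (X·A) = coproj X` for a unit `A`. [folklore] -/
theorem coproj_mul_unit (X : Matrix n m 𝕜) {A : Matrix m m 𝕜} (hA : IsUnit A) : coproj (X * A) = coproj X := by
  have hAd : IsUnit A.det := (isUnit_iff_isUnit_det _).mp hA
  have hAhd : IsUnit Aᴴ.det := by rw [det_conjTranspose]; exact hAd.star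
  have hgram : (X * A)ᴴ * (X * A) = Aᴴ * ((Xᴴ * X) * A) := by rw [conjTranspose_mul]; simp only [Matrix.mul_assoc]
  have hinv : ((X * A)ᴴ * (X * A))⁻¹ = A⁻¹ * (Xᴴ * X)⁻¹ * Aᴴ⁻¹ := by
    rw [hgram, Matrix.mul_inv_rev, Matrix.mul_inv_rev, Matrix.mul_assoc]
  unfold coproj
  rw [hinv, conjTranspose_mul]
  congr 1
  calc X * A * (A⁻¹ * (Xᴴ * X)⁻¹ * Aᴴ⁻¹) * (Aᴴ * Xᴴ)
      = X * (A * A⁻¹) * (Xᴴ * X)⁻¹ * (Aᴴ⁻¹ * Aᴴ) * Xᴴ := by simp only [Matrix.mul_assoc]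
    _ = X * (Xᴴ * X)⁻¹ * Xᴴ := by rw [mul_nonsing_inv _ hAd, nonsing_inv_mul _ hAhd, Matrix.mul_one, Matrix.mul_one]

/-- **trace of a coprojector**: `tr (coproj X) = #(row index) − #(column index)` when the Gram matrix is a unit. [folklore] -/
theorem trace_coproj {X : Matrix n m 𝕜} (hG : IsUnit (Xᴴ * X)) :
    trace (coproj X) = (Fintype.card n : 𝕜) - Fintype.card m := by
  have hG' := (isUnit_iff_isUnit_det _).mp hG
  rw [coproj, trace_sub, trace_one, Matrix.mul_assoc, trace_mul_comm, Matrix.mul_assoc, nonsing_inv_mul _ hG', trace_one]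

/-! ## §2 `R = L·𝒮·L` is the coprojector of the one-form minimiser columns

Notation: `H_T := L + QᴴTQ`, `Γ := flucCov H_T Q`, `ℋ := minimiser H_T Q`, `E := effForm H_T Q − T`; `𝒮 := flucCov (L·L + QᴴT₂Q) Q`
(`= Γ·coproj ℋ·Γ` by R17, independent of `T₂`). -/

/-- `ℋᴴ·L = Eᴴ·Q` (conjugate of R17's `L·ℋ = Qᴴ·E`): the minimiser columns are `L`-orthogonal to `ker Q`. [folklore] -/
theorem conjTranspose_minimiser_mul_base {L : Matrix n n 𝕜} {Q : Matrix m n 𝕜} {T : Matrix m m 𝕜} (hL : Lᴴ = L)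
    (hHT : IsUnit (L + Qᴴ * T * Q)) (hP : IsUnit (pivot (L + Qᴴ * T * Q) Q)) :
    (minimiser (L + Qᴴ * T * Q) Q)ᴴ * L = (effForm (L + Qᴴ * T * Q) Q - T)ᴴ * Q := by
  have h := congrArg conjTranspose (base_mul_minimiser_reg T hHT hP)
  rw [conjTranspose_mul, conjTranspose_mul, conjTranspose_conjTranspose, hL] at h
  exact h

/-- **`L · 𝒮 · L = coproj ℋ`** — Bałaban's `R = Δ𝒮Δ` ([B9] (2.27), (3.25)) at `U = 1` is the orthogonal coprojector of King's one-form
minimiser columns; exact, for every admissible pair of regularisers `T, T₂`. [folklore] -/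
theorem base_mul_flucCov_sq_mul_base {L : Matrix n n 𝕜} {Q : Matrix m n 𝕜} {T : Matrix m m 𝕜} (hL : Lᴴ = L) (hT : Tᴴ = T)
    (hHT : IsUnit (L + Qᴴ * T * Q)) (hP : IsUnit (pivot (L + Qᴴ * T * Q) Q))
    (hG : IsUnit ((minimiser (L + Qᴴ * T * Q) Q)ᴴ * minimiser (L + Qᴴ * T * Q) Q))
    (T₂ : Matrix m m 𝕜) (hHT₂ : IsUnit (L * L + Qᴴ * T₂ * Q)) (hP₂ : IsUnit (pivot (L * L + Qᴴ * T₂ * Q) Q)) :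
    L * flucCov (L * L + Qᴴ * T₂ * Q) Q * L = coproj (minimiser (L + Qᴴ * T * Q) Q) := by
  rw [flucCov_sq_reg hL hT hHT hP hG T₂ hHT₂ hP₂]
  have hHh : (L + Qᴴ * T * Q).IsHermitian := isHermitian_reg hL hT
  have hΓL := flucCov_reg_mul_base T hHT hP
  have hLΓ : L * flucCov (L + Qᴴ * T * Q) Q = 1 - Qᴴ * (minimiser (L + Qᴴ * T * Q) Q)ᴴ := by
    rw [base_mul_flucCov_reg T hHT hP, comultiplier_eq_conjTranspose hHh]
  have hℋP := conjTranspose_mul_coproj hG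
  have hPℋ := coproj_mul_self hG
  set Γ := flucCov (L + Qᴴ * T * Q) Q with hΓdef
  set ℋ := minimiser (L + Qᴴ * T * Q) Q with hℋdef
  calc L * (Γ * coproj ℋ * Γ) * L = (L * Γ) * coproj ℋ * (Γ * L) := by simp only [Matrix.mul_assoc]
    _ = (1 - Qᴴ * ℋᴴ) * coproj ℋ * (1 - ℋ * Q) := by rw [hLΓ, hΓL]
    _ = coproj ℋ := by
        rw [Matrix.sub_mul, Matrix.one_mul, Matrix.mul_assoc Qᴴ, hℋP, Matrix.mul_zero, sub_zero, Matrix.mul_sub, Matrix.mul_one,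
          ← Matrix.mul_assoc, hPℋ, Matrix.zero_mul, sub_zero]

/-- **the (3.25) shape**: `coproj ℋ = 1 − G′Qᴴ(QG′G′Qᴴ)⁻¹QG′` with `G′ = H⁻¹` ([B9] p. 394 (3.25) «R = I − G′Q′*(Q′G′²Q′*)⁻¹Q′G′» —
locator; the coprojector of `ℋ = G′QᴴΔ_eff` is that of `G′Qᴴ`). [folklore] -/
theorem coproj_minimiser_eq_balaban325 {H : Matrix n n 𝕜} {Q : Matrix m n 𝕜} (hH : H.IsHermitian) (hP : IsUnit (pivot H Q)) :
    coproj (minimiser H Q) = 1 - H⁻¹ * Qᴴ * (Q * H⁻¹ * H⁻¹ * Qᴴ)⁻¹ * Q * H⁻¹ := by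
  have hinvH : (H⁻¹)ᴴ = H⁻¹ := by rw [conjTranspose_nonsing_inv, hH.eq]
  rw [minimiser, coproj_mul_unit (H⁻¹ * Qᴴ) (isUnit_effForm hP), coproj, conjTranspose_mul, conjTranspose_conjTranspose, hinvH]
  simp only [Matrix.mul_assoc]

/-- **`R` FIXES `L(ker Q)`** ((3.21), inclusion ⊇): `coproj ℋ · (L κ) = L κ` whenever `Q κ = 0`. [folklore] -/
theorem coproj_minimiser_mulVec_base {L : Matrix n n 𝕜} {Q : Matrix m n 𝕜} {T : Matrix m m 𝕜} (hL : Lᴴ = L)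
    (hHT : IsUnit (L + Qᴴ * T * Q)) (hP : IsUnit (pivot (L + Qᴴ * T * Q) Q)) {κ : n → 𝕜} (hκ : Q *ᵥ κ = 0) :
    coproj (minimiser (L + Qᴴ * T * Q) Q) *ᵥ (L *ᵥ κ) = L *ᵥ κ := by
  rw [Matrix.mulVec_mulVec, coproj, Matrix.sub_mul, Matrix.one_mul, Matrix.sub_mulVec, sub_eq_self]
  have e : minimiser (L + Qᴴ * T * Q) Q * ((minimiser (L + Qᴴ * T * Q) Q)ᴴ * minimiser (L + Qᴴ * T * Q) Q)⁻¹
      * (minimiser (L + Qᴴ * T * Q) Q)ᴴ * L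
      = minimiser (L + Qᴴ * T * Q) Q * ((minimiser (L + Qᴴ * T * Q) Q)ᴴ * minimiser (L + Qᴴ * T * Q) Q)⁻¹
          * ((minimiser (L + Qᴴ * T * Q) Q)ᴴ * L) := by simp only [Matrix.mul_assoc]
  have hEQ : ((effForm (L + Qᴴ * T * Q) Q - T)ᴴ * Q) *ᵥ κ = 0 := by rw [← Matrix.mulVec_mulVec, hκ, Matrix.mulVec_zero]
  rw [e, conjTranspose_minimiser_mul_base hL hHT hP, ← Matrix.mulVec_mulVec, hEQ, Matrix.mulVec_zero]

end Algebra

/-! ## §2b The variational reading ((3.22)) of a symmetric idempotent matrix -/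

section Variational

variable {ι : Type*} [Fintype ι]

/-- **best approximation**: a symmetric idempotent `R` fixing `w` has `‖v − Rv‖² ≤ ‖v − w‖²` — with `R` the coprojector and `w = Lλ`,
`Qλ = 0`, this is [B9] (3.22): `Rv = Lλ₀`, `λ₀` minimising `λ ↦ ‖v − Lλ‖²` over `N(Q)`. [folklore] -/
theorem proj_variational {R : Matrix ι ι ℝ} (hRt : Rᵀ = R) (hRR : R * R = R) (v w : ι → ℝ) (hw : R *ᵥ w = w) :
    (v - R *ᵥ v) ⬝ᵥ (v - R *ᵥ v) ≤ (v - w) ⬝ᵥ (v - w) := by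
  have hb : R *ᵥ v - w = R *ᵥ (v - w) := by rw [Matrix.mulVec_sub, hw]
  have h1 : (v - R *ᵥ v) ᵥ* R = 0 := by
    rw [← Matrix.mulVec_transpose, hRt, Matrix.mulVec_sub, Matrix.mulVec_mulVec, hRR, sub_self]
  have horth : (v - R *ᵥ v) ⬝ᵥ (R *ᵥ (v - w)) = 0 := by rw [Matrix.dotProduct_mulVec, h1, zero_dotProduct]
  have hsplit : v - w = (v - R *ᵥ v) + R *ᵥ (v - w) := by rw [← hb]; abel
  have hnn : 0 ≤ (R *ᵥ (v - w)) ⬝ᵥ (R *ᵥ (v - w)) := Finset.sum_nonneg fun i _ => mul_self_nonneg _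
  rw [hsplit, add_dotProduct, dotProduct_add, dotProduct_add, horth, dotProduct_comm (R *ᵥ (v - w)) (v - R *ᵥ v), horth]
  linarith

end Variational

/-! ## §3 Bałaban's `R(1)` on the Neumann boxes at `A = 0`: identity, projection property, N-uniform smallness of `1 − R` -/

section Box

open Literature.MathematicalPhysics.QuantumFieldTheory.Balaban1983to89
open B4Reflection242 (boxDom)
open B4BoxCov237 (boxOpR indB rho rho_isPseudoDist boxOpR_isUnit)
open B4Sect5Torus (IsPseudoDist rate rate_pos rate_le_quarter)
open B4Sect5Proof (latticeConst)
open B5Decay126 (PosDecay PosProfile)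
open B6QGQLower276 (gammaQ gammaQ_pos)
open WoodburyFibreGaugeDecay (posDecay_conjTranspose)
open WoodburyFibreGaugeCubeDecay (CubeDecay ColCubeDecay posDecay_mul_colCube gram_posDecay)
open WoodburyFibreBoxQGQ (fineN blkBox qGq_box_coercive)
open WoodburyFibreGaugeInputs
open WoodburyFibreGaugeBox
open WoodburyFibreLandauBox (piH dStar dOne vRate_pos flucCov_smul_real)
open WoodburyFibreLandauLimit (landauOp landauCov landauOp_eq isUnit_landauPivot)

noncomputable section

variable {d : ℕ}

/-- **Bałaban's projection `R` at `U = 1` on the Neumann box** (massless, `A = 0`): `R := L_n · Γ^{Landau}_n · L_n`, `L_n = boxOpR n 0 0 M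
= n²(−Δ^N_X)`, `Γ^{Landau}_n = landauCov n M` the block-constrained inverse of `L_n·L_n` — the box version of an2's `R(1) = L·Sb·L`
([B9] (3.21)∕(3.25) at `U = 1`: locator). [folklore] -/
def projR (n : ℕ) (M : Fin (d + 1) → ℕ) : Matrix ↥(boxDom (fineN n M)) ↥(boxDom (fineN n M)) ℝ :=
  boxOpR n 0 0 M * landauCov n M * boxOpR n 0 0 M

section OneBox

variable {n : ℕ}

/-- the regularised one-form operator `boxOpR n 1 0 M = L_n + Qnᴴ·1·Qn` (R17's shape). [folklore] -/
theorem boxOpR_one_eq (hn : 1 ≤ n) (M : Fin (d + 1) → ℕ) :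
    boxOpR n 1 0 M = boxOpR n 0 0 M + (Qn n M)ᴴ * (1 : Matrix ↥(boxDom M) ↥(boxDom M) ℝ) * Qn n M := by
  rw [boxOpR_eq_reg M hn 1 0, one_smul]

/-- the pivot `Qn·(boxOpR n 1 0 M)⁻¹·Qnᴴ = Q_kG_kQ_k^*` is a unit (coercive by gen 6's box (2.76)). [folklore] -/
theorem isUnit_pivot_one (hn : 1 ≤ n) (M : Fin (d + 1) → ℕ) (hM : ∀ i, 1 ≤ M i) : IsUnit (pivot (boxOpR n 1 0 M) (Qn n M)) := by
  rw [pivot_eq M hn]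
  exact QGQInverse.isUnit_of_coercive (gammaQ_pos _ (by norm_num)) (qGq_box_coercive (d := d) hn one_pos le_rfl hM)

/-- **the capacitance `ℋ̃ᴴℋ̃ ⪰ 1`** (R17 §3b with `QnQnᴴ = 1`). [folklore] -/
theorem gram_coercive (hn : 1 ≤ n) (M : Fin (d + 1) → ℕ) (hM : ∀ i, 1 ≤ M i) :
    QGQInverse.Coercive ((minimiser (boxOpR n 1 0 M) (Qn n M))ᴴ * minimiser (boxOpR n 1 0 M) (Qn n M)) 1 :=
  fun x => (gram_coercive_one M hn x).trans
    (gram_minimiser_form_ge (boxOpR_conjTranspose M 1 0) (isUnit_pivot_one hn M hM) (isUnit_gram M hn) x)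

/-- … hence a unit. [folklore] -/
theorem isUnit_gramMinimiser (hn : 1 ≤ n) (M : Fin (d + 1) → ℕ) (hM : ∀ i, 1 ≤ M i) :
    IsUnit ((minimiser (boxOpR n 1 0 M) (Qn n M))ᴴ * minimiser (boxOpR n 1 0 M) (Qn n M)) :=
  QGQInverse.isUnit_of_coercive one_pos (gram_coercive hn M hM)

/-- the box Landau operator in R17's normalisation: `Γ^{Landau}_n = flucCov (L_n·L_n + Qnᴴ(n^{d+1}·1)Qn) Qn`. [folklore] -/
theorem landauCov_eq (hn : 1 ≤ n) (M : Fin (d + 1) → ℕ) (hM : ∀ i, 1 ≤ M i) : landauCov n M = flucCov (boxOpR n 0 0 M * boxOpR n 0 0 M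
    + (Qn n M)ᴴ * (((n : ℝ) ^ (d + 1)) • (1 : Matrix ↥(boxDom M) ↥(boxDom M) ℝ)) * Qn n M) (Qn n M) := by
  have hn0 : (0 : ℝ) < n := by exact_mod_cast hn
  have hs : (sN d n)⁻¹ ≠ 0 := inv_ne_zero (sN_pos (d := d) hn).ne'
  have hQ : indB n M = (sN d n)⁻¹ • Qn n M := by
    rw [Qn, smul_smul, inv_mul_cancel₀ (sN_pos (d := d) hn).ne', one_smul]
  rw [landauCov, landauOp_eq hn M, hQ]
  exact flucCov_smul_real _ _ hs (isUnit_pivot_biForm hn M hM le_rfl (by positivity))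

/-- **`R = coproj ℋ̃` ON THE BOX**: Bałaban's `R(1)` is the coprojector of the minimiser columns `ℋ̃ = minimiser (boxOpR n 1 0 M) Qn`
(`H_k(□)` in the unitary normalisation). [folklore] -/
theorem projR_eq_coproj (hn : 1 ≤ n) (M : Fin (d + 1) → ℕ) (hM : ∀ i, 1 ≤ M i) :
    projR n M = coproj (minimiser (boxOpR n 1 0 M) (Qn n M)) := by
  have hn0 : (0 : ℝ) < n := by exact_mod_cast hn
  have hreg := boxOpR_one_eq hn M
  have h := base_mul_flucCov_sq_mul_base (L := boxOpR n 0 0 M) (Q := Qn n M) (T := (1 : Matrix ↥(boxDom M) ↥(boxDom M) ℝ))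
    (boxOpR_conjTranspose M 0 0) conjTranspose_one (by rw [← hreg]; exact boxOpR_isUnit hn one_pos le_rfl hM)
    (by rw [← hreg]; exact isUnit_pivot_one hn M hM) (by rw [← hreg]; exact isUnit_gramMinimiser hn M hM)
    (((n : ℝ) ^ (d + 1)) • (1 : Matrix ↥(boxDom M) ↥(boxDom M) ℝ)) (isUnit_biForm hn M hM le_rfl (by positivity))
    (isUnit_pivot_biForm hn M hM le_rfl (by positivity))
  rw [← hreg] at h
  rw [projR, landauCov_eq hn M hM]
  exact h

/-- `R` is symmetric. [folklore] -/
theorem projR_transpose (hn : 1 ≤ n) (M : Fin (d + 1) → ℕ) (hM : ∀ i, 1 ≤ M i) : (projR n M)ᵀ = projR n M := by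
  rw [← conjTranspose_eq_transpose_of_trivial, projR_eq_coproj hn M hM, coproj_conjTranspose]

/-- `R` is idempotent. [folklore] -/
theorem projR_mul_projR (hn : 1 ≤ n) (M : Fin (d + 1) → ℕ) (hM : ∀ i, 1 ≤ M i) : projR n M * projR n M = projR n M := by
  rw [projR_eq_coproj hn M hM, coproj_mul_coproj (isUnit_gramMinimiser hn M hM)]

/-- **rank count**: `tr R = #(fine sites of the box) − #(blocks)`. [folklore] -/
theorem trace_projR (hn : 1 ≤ n) (M : Fin (d + 1) → ℕ) (hM : ∀ i, 1 ≤ M i) :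
    trace (projR n M) = (Fintype.card ↥(boxDom (fineN n M)) : ℝ) - Fintype.card ↥(boxDom M) := by
  rw [projR_eq_coproj hn M hM, trace_coproj (isUnit_gramMinimiser hn M hM)]

/-- **the (3.25) shape on the box**: `R = 1 − G·Qnᴴ·(Qn·G·G·Qnᴴ)⁻¹·Qn·G`, `G = (boxOpR n 1 0 M)⁻¹` (`Qn = n^{−(d+1)∕2}·S` is Bałaban's
`Q_k` up to a normalisation the formula does not see). [folklore] -/
theorem projR_eq_balaban325 (hn : 1 ≤ n) (M : Fin (d + 1) → ℕ) (hM : ∀ i, 1 ≤ M i) : projR n M = 1 - (boxOpR n 1 0 M)⁻¹ * (Qn n M)ᴴ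
    * (Qn n M * (boxOpR n 1 0 M)⁻¹ * (boxOpR n 1 0 M)⁻¹ * (Qn n M)ᴴ)⁻¹ * Qn n M * (boxOpR n 1 0 M)⁻¹ := by
  rw [projR_eq_coproj hn M hM]
  exact coproj_minimiser_eq_balaban325 (boxOpR_conjTranspose M 1 0) (isUnit_pivot_one hn M hM)

/-- **`R` fixes `L_n κ` for every `κ` with zero block sums** ((3.21) ⊇). [folklore] -/
theorem projR_mulVec_base (hn : 1 ≤ n) (M : Fin (d + 1) → ℕ) (hM : ∀ i, 1 ≤ M i) {κ : ↥(boxDom (fineN n M)) → ℝ}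
    (hκ : indB n M *ᵥ κ = 0) : projR n M *ᵥ (boxOpR n 0 0 M *ᵥ κ) = boxOpR n 0 0 M *ᵥ κ := by
  have hreg := boxOpR_one_eq hn M
  have hQκ : Qn n M *ᵥ κ = 0 := by rw [Qn, Matrix.smul_mulVec, hκ, smul_zero]
  have h := coproj_minimiser_mulVec_base (L := boxOpR n 0 0 M) (Q := Qn n M) (T := (1 : Matrix ↥(boxDom M) ↥(boxDom M) ℝ))
    (boxOpR_conjTranspose M 0 0) (by rw [← hreg]; exact boxOpR_isUnit hn one_pos le_rfl hM)
    (by rw [← hreg]; exact isUnit_pivot_one hn M hM) hQκ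
  rw [← hreg] at h
  rw [projR_eq_coproj hn M hM]
  exact h

/-- **the columns of `R` lie in `L_n(ker S)`** ((3.21) ⊆ ∕ (3.22)): `R = L_n·W` with `S·W = 0` (`W = Γ^{Landau}_n·L_n`). [folklore] -/
theorem projR_eq_base_mul (hn : 1 ≤ n) (M : Fin (d + 1) → ℕ) (hM : ∀ i, 1 ≤ M i) :
    projR n M = boxOpR n 0 0 M * (landauCov n M * boxOpR n 0 0 M) ∧ indB n M * (landauCov n M * boxOpR n 0 0 M) = 0 := by
  refine ⟨by rw [projR, Matrix.mul_assoc], ?_⟩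
  rw [← Matrix.mul_assoc, landauCov, constraint_mul_flucCov (isUnit_landauPivot hn M hM), Matrix.zero_mul]

/-- **the variational reading (3.22) on the box**: `R v` minimises `‖v − L_n κ‖²` over all `κ` with zero block sums. [folklore] -/
theorem projR_variational (hn : 1 ≤ n) (M : Fin (d + 1) → ℕ) (hM : ∀ i, 1 ≤ M i) (v κ : ↥(boxDom (fineN n M)) → ℝ)
    (hκ : indB n M *ᵥ κ = 0) :
    (v - projR n M *ᵥ v) ⬝ᵥ (v - projR n M *ᵥ v) ≤ (v - boxOpR n 0 0 M *ᵥ κ) ⬝ᵥ (v - boxOpR n 0 0 M *ᵥ κ) :=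
  proj_variational (projR_transpose hn M hM) (projR_mul_projR hn M hM) v _ (projR_mulVec_base hn M hM hκ)

/-- `1 − R = ℋ̃(ℋ̃ᴴℋ̃)⁻¹ℋ̃ᴴ` (the projector onto the minimiser columns). [folklore] -/
theorem one_sub_projR (hn : 1 ≤ n) (M : Fin (d + 1) → ℕ) (hM : ∀ i, 1 ≤ M i) : 1 - projR n M = minimiser (boxOpR n 1 0 M) (Qn n M)
    * ((minimiser (boxOpR n 1 0 M) (Qn n M))ᴴ * minimiser (boxOpR n 1 0 M) (Qn n M))⁻¹ * (minimiser (boxOpR n 1 0 M) (Qn n M))ᴴ := by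
  rw [projR_eq_coproj hn M hM, coproj, sub_sub_cancel]

end OneBox

/-! ### The N-uniform smallness of `1 − R`, from gen 6's minimiser decays -/

/-- the rate of `1 − R`: `δ₁∕4`, `δ₁ = dOne` the capacitance rate of `WoodburyFibreLandauBox`. [folklore] -/
def pRate (K : ℝ → ℝ) (γ cG δ : ℝ) : ℝ := dOne K γ cG δ / 4

/-- the constant of `1 − R` in the cube currency (the entrywise constant is this times `n^{−(d+1)}`). [folklore] -/
def pConst (K : ℝ → ℝ) (γ cG δ : ℝ) : ℝ := piH K γ cG δ * 2 * K (dOne K γ cG δ / 2) * K (dOne K γ cG δ / 4)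

/-- `0 < dOne`. [folklore] -/
theorem dOne_pos {K : ℝ → ℝ} (hK0 : ∀ t, 0 < t → 0 ≤ K t) {γ cG δ : ℝ} (hγ : 0 < γ) (hc : 0 ≤ cG) (hδ : 0 < δ) : 0 < dOne K γ cG δ := by
  have h := vRate_pos hK0 hγ hc hδ; unfold WoodburyFibreLandauBox.vRate at h; linarith

/-- `0 < pConst` for the lattice profile and `cG > 0`. [folklore] -/
theorem pConst_pos (d : ℕ) {γ cG δ : ℝ} (hγ : 0 < γ) (hc : 0 < cG) (hδ : 0 < δ) : 0 < pConst (latticeConst (d + 1)) γ cG δ := by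
  have hK0 := latticeConst_nonneg' d
  have hP := rate_pos hK0 hγ hc.le hδ
  have hD := dOne_pos hK0 hγ hc.le hδ
  have hK1 : ∀ t : ℝ, 0 < t → 0 < latticeConst (d + 1) t :=
    fun t ht => lt_of_lt_of_le one_pos (B4Thm110ZeroBox.one_le_latticeConst d ht)
  have hπ : 0 < piH (latticeConst (d + 1)) γ cG δ := by
    unfold piH; exact mul_pos (by positivity) (pow_pos (hK1 _ (by positivity)) 2)
  unfold pConst
  exact mul_pos (mul_pos (mul_pos hπ two_pos) (hK1 _ (by positivity))) (hK1 _ (by positivity))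

/-- **`1 − R` on one box from the scalar data**: cube decay `(cG, δ)` of `G = (boxOpR n 1 0 M)⁻¹` and coercivity `γ` of `Q_kG_kQ_k^*` give
ENTRYWISE decay with constant `n^{−(d+1)}·pConst` and CUBE decay with constant `pConst`, both at rate `pRate`. [folklore] -/
theorem one_sub_projR_of_data {n : ℕ} (hn : 1 ≤ n) (M : Fin (d + 1) → ℕ) (hM : ∀ i, 1 ≤ M i) {cG δ γ : ℝ} (hδ : 0 < δ)
    (hγ : 0 < γ) (hG : CubeDecay (rho M) (blkBox hn M) id (boxOpR n 1 0 M)⁻¹ cG δ)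
    (hco : QGQInverse.Coercive ((((n : ℝ) ^ (d + 1))⁻¹) • (indB n M * (boxOpR n 1 0 M)⁻¹ * (indB n M)ᵀ)) γ) :
    PosDecay (rho M) (id ∘ blkBox hn M) (id ∘ blkBox hn M) (1 - projR n M)
        ((((n : ℝ) ^ (d + 1))⁻¹) * pConst (latticeConst (d + 1)) γ cG δ) (pRate (latticeConst (d + 1)) γ cG δ)
      ∧ CubeDecay (rho M) (blkBox hn M) id (1 - projR n M) (pConst (latticeConst (d + 1)) γ cG δ) (pRate (latticeConst (d + 1)) γ cG δ) := by
  have hd := rho_isPseudoDist M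
  have hK0 := latticeConst_nonneg' d
  have hK := posProfile_rho M
  have hP := rate_pos hK0 hγ hG.1 hδ
  have hS4 : 0 < dStar (latticeConst (d + 1)) γ cG δ := by unfold dStar; positivity
  -- gen 6's minimiser decays, weakened to the common rate `δ* = δP/4`
  have hH : PosDecay (rho M) (id ∘ blkBox hn M) id (minimiser (boxOpR n 1 0 M) (Qn n M))
      (sN d n * cG * (2 / γ) * latticeConst (d + 1) (rate (latticeConst (d + 1)) γ cG δ / 2)) (dStar (latticeConst (d + 1)) γ cG δ) :=
    PosDecay.mono hd.nonneg (posDecay_minimiser hn M hδ hγ hG hco) (by unfold dStar; linarith)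
  have hH' : ColCubeDecay (rho M) (blkBox hn M) id (minimiser (boxOpR n 1 0 M) (Qn n M))
      (sN d n * ((n : ℝ) ^ (d + 1) * cG) * (2 / γ) * latticeConst (d + 1) (rate (latticeConst (d + 1)) γ cG δ / 2))
      (dStar (latticeConst (d + 1)) γ cG δ) :=
    ColCubeDecay.mono hd (colCube_minimiser hn M hδ hγ hG hco) (by unfold dStar; linarith)
  -- the capacitance entrywise, and its inverse by finite Combes–Thomas with coercivity `1`
  have hGram := gram_posDecay hd hK0 hK hH hH' (δ' := dStar (latticeConst (d + 1)) γ cG δ / 2)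
    (g := dStar (latticeConst (d + 1)) γ cG δ / 2) (by positivity) (by positivity) (by linarith) (by linarith)
  have hprod : sN d n * cG * (2 / γ) * latticeConst (d + 1) (rate (latticeConst (d + 1)) γ cG δ / 2)
      * (sN d n * ((n : ℝ) ^ (d + 1) * cG) * (2 / γ) * latticeConst (d + 1) (rate (latticeConst (d + 1)) γ cG δ / 2))
      = piH (latticeConst (d + 1)) γ cG δ := by
    unfold piH
    calc _ = (sN d n * sN d n * (n : ℝ) ^ (d + 1)) * (cG ^ 2 * (2 / γ) ^ 2
        * latticeConst (d + 1) (rate (latticeConst (d + 1)) γ cG δ / 2) ^ 2) := by ring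
      _ = _ := by rw [sN_mul_sN_mul (d := d) hn, one_mul]
  rw [hprod] at hGram
  have hSi := B5Decay126.PosDecay.inv hd hK0 hK one_pos (by positivity : 0 < dStar (latticeConst (d + 1)) γ cG δ / 2) hGram
    (gram_coercive hn M hM)
  change PosDecay (rho M) id id _ (2 / 1) (dOne (latticeConst (d + 1)) γ cG δ) at hSi
  have hD := dOne_pos hK0 hγ hG.1 hδ
  have hDle : dOne (latticeConst (d + 1)) γ cG δ ≤ dStar (latticeConst (d + 1)) γ cG δ / 2 / 4 := rate_le_quarter _ _ _
  -- the leg `ℋ̃·(ℋ̃ᴴℋ̃)⁻¹`, then `·ℋ̃ᴴ` entrywise and in the cube currency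
  have h2 := B5Decay126.PosDecay.mul hd hK0 hK hH hSi (δ' := dOne (latticeConst (d + 1)) γ cG δ / 2)
    (g := dOne (latticeConst (d + 1)) γ cG δ / 2) (by positivity) (by positivity) (by linarith) (by linarith)
  have h3e := B5Decay126.PosDecay.mul hd hK0 hK h2 (posDecay_conjTranspose hd hH) (δ' := dOne (latticeConst (d + 1)) γ cG δ / 4)
    (g := dOne (latticeConst (d + 1)) γ cG δ / 4) (by positivity) (by positivity) (by linarith) (by linarith)
  have h3c := posDecay_mul_colCube hd hK0 hK h2 hH' (δ' := dOne (latticeConst (d + 1)) γ cG δ / 4)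
    (g := dOne (latticeConst (d + 1)) γ cG δ / 4) (by positivity) (by positivity) (by linarith) (by linarith)
  rw [← one_sub_projR hn M hM] at h3e h3c
  have e3 : sN d n * cG * (2 / γ) * latticeConst (d + 1) (rate (latticeConst (d + 1)) γ cG δ / 2) * (2 / 1)
      * latticeConst (d + 1) (dOne (latticeConst (d + 1)) γ cG δ / 2)
      * (sN d n * cG * (2 / γ) * latticeConst (d + 1) (rate (latticeConst (d + 1)) γ cG δ / 2))
      * latticeConst (d + 1) (dOne (latticeConst (d + 1)) γ cG δ / 4)
      = ((n : ℝ) ^ (d + 1))⁻¹ * pConst (latticeConst (d + 1)) γ cG δ := by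
    rw [← sN_mul_sN hn]; unfold pConst piH; ring
  have e4 : sN d n * cG * (2 / γ) * latticeConst (d + 1) (rate (latticeConst (d + 1)) γ cG δ / 2) * (2 / 1)
      * latticeConst (d + 1) (dOne (latticeConst (d + 1)) γ cG δ / 2)
      * (sN d n * ((n : ℝ) ^ (d + 1) * cG) * (2 / γ) * latticeConst (d + 1) (rate (latticeConst (d + 1)) γ cG δ / 2))
      * latticeConst (d + 1) (dOne (latticeConst (d + 1)) γ cG δ / 4)
      = pConst (latticeConst (d + 1)) γ cG δ := by
    unfold pConst; rw [← hprod]; ring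
  rw [e3] at h3e
  rw [e4] at h3c
  exact ⟨h3e, h3c⟩

/-- **`1 − R` IS SMALL AND DECAYS, UNIFORMLY IN THE SCALE** (all `k ≥ 1`, `n = (ℓ+1)^k`, all boxes): `|(1 − R)(x, y)| ≤ C·n^{−(d+1)}·e^{−δ|blk x − blk y|_∞}`
(the natural size of the rank-`#blocks` projector onto the minimiser columns) and `Σ_{y ∈ b′}|(1 − R)(x, y)| ≤ C·e^{−δ|blk x − b′|_∞}` (cube
currency); `(δ, C)` explicit functions of `(d, ℓ)` through B4 (1.10)'s `(δ₀, c₀)` and `gammaQ`.  Census row V11. [folklore] -/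
theorem one_sub_projR_decay (d ℓ : ℕ) (hℓ : 1 ≤ ℓ) :
    ∃ δ C : ℝ, 0 < δ ∧ 0 < C ∧ ∀ (k : ℕ) (hk : 1 ≤ k) (M : Fin (d + 1) → ℕ), (∀ i, 1 ≤ M i) →
      PosDecay (rho M) (id ∘ blkBox (Nat.one_le_pow k (ℓ + 1) (Nat.succ_pos ℓ)) M)
          (id ∘ blkBox (Nat.one_le_pow k (ℓ + 1) (Nat.succ_pos ℓ)) M) (1 - projR ((ℓ + 1) ^ k) M)
          (C * ((((ℓ + 1) ^ k : ℕ) : ℝ) ^ (d + 1))⁻¹) δ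
        ∧ CubeDecay (rho M) (blkBox (Nat.one_le_pow k (ℓ + 1) (Nat.succ_pos ℓ)) M) id (1 - projR ((ℓ + 1) ^ k) M) C δ := by
  obtain ⟨δ₀, c₀, hδ₀, hc₀, hG⟩ := cubeDecay_boxGreen d ℓ hℓ 1 1 0 one_pos
  have hγ : 0 < gammaQ (d + 1) (0 + 1) := gammaQ_pos _ (by norm_num)
  refine ⟨pRate (latticeConst (d + 1)) (gammaQ (d + 1) (0 + 1)) c₀ δ₀, pConst (latticeConst (d + 1)) (gammaQ (d + 1) (0 + 1)) c₀ δ₀,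
    ?_, pConst_pos d hγ hc₀ hδ₀, fun k hk M hM => ?_⟩
  · unfold pRate; exact div_pos (dOne_pos (latticeConst_nonneg' d) hγ hc₀.le hδ₀) (by norm_num)
  have hn : 1 ≤ (ℓ + 1) ^ k := Nat.one_le_pow k (ℓ + 1) (Nat.succ_pos ℓ)
  have h := one_sub_projR_of_data hn M hM hδ₀ hγ (hG k hk 1 0 le_rfl le_rfl le_rfl le_rfl M hM)
    (qGq_box_coercive (d := d) hn one_pos le_rfl hM)
  refine ⟨?_, h.2⟩
  rw [mul_comm (pConst (latticeConst (d + 1)) (gammaQ (d + 1) (0 + 1)) c₀ δ₀)]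
  exact h.1

/-! ## §4 Non-vacuity: the physical case `d + 1 = 4`, `L = 2` -/

/-- `one_sub_projR_decay` at `d + 1 = 4`, `L = 2`; the quantifier prefix is inhabited (`k = 1`, the unit cube `M ≡ 1`). -/
example : ∃ δ C : ℝ, 0 < δ ∧ 0 < C ∧ ∀ (k : ℕ) (hk : 1 ≤ k) (M : Fin (3 + 1) → ℕ), (∀ i, 1 ≤ M i) →
      PosDecay (rho M) (id ∘ blkBox (Nat.one_le_pow k (1 + 1) (Nat.succ_pos 1)) M)
          (id ∘ blkBox (Nat.one_le_pow k (1 + 1) (Nat.succ_pos 1)) M) (1 - projR ((1 + 1) ^ k) M)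
          (C * ((((1 + 1) ^ k : ℕ) : ℝ) ^ (3 + 1))⁻¹) δ
        ∧ CubeDecay (rho M) (blkBox (Nat.one_le_pow k (1 + 1) (Nat.succ_pos 1)) M) id (1 - projR ((1 + 1) ^ k) M) C δ :=
  one_sub_projR_decay 3 1 le_rfl

end

end Box

end Summit.QuantumFields.BalabanUV.Beta.GAN24.WoodburyFibreProjector
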